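import Summits.CriticalPhenomena.PercolationContinuityZ3.Theorems.PercNearOneGluingNoHeavyLowerTailKnQuestion8CoefficientwiseCoreClassKernelMixHubBundleCluster
import HarnessLib

/-!
# The HE PURE LEMMA on every explicit bundle, consumer form: hypotheses of `iet01_bundle_threadSupported`, no word-form data

Support file (`--supports stmt-CriticalPhenomena-4575`, closed), prover `prim-cplus-coupling` (gen 52).  No definitions, no notations,
no named facts, no sorries; standard axioms.  Memo `prim-cplus-coupling/A5-COUPLING-gen52.md` §1.5.

`bundle_HEpure_cluster` (…KernelMixHubBundleCluster) carries the word-form data (`Ẽ, θ, D, ri, …, TX, TY`) as hypothesis-style parameters and asks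
`1 ≤ L t` for every `t`.  This file discharges all of that: **`bundle_bad1_le_L1`** has exactly the bundle hypotheses of
`iet01_bundle_threadSupported` (…KernelMixBundleIET: `ends, r, L, hL, w, e, u, b, hw0, hwL, harc, hwinj, hcross, A, hA, hAdisj, E, hEA`) plus `0 < r`,
four ARBITRARY monotone levels `hᵃ, hᵇ, kᵃ, kᵇ : Set V → Prop` and an up-closed event `𝒱`, and concludes
  `#{ω ⊆ E : 𝒱 ω, b∉X, b∈Y, hᵃX, ¬hᵇY, kᵇY, ¬kᵃX} ≤ #{ω ⊆ E : 𝒱 ω, b∈X, b∉Y, hᵃX, ¬hᵇY, kᵇX, ¬kᵃY}`   (`X = C_u(ω)`, `Y = C_u(E∖ω)`),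
i.e. `#bad₁(𝒱) ≤ #L₁(𝒱)` for every bundle and all 0/1 levels (the single-type half of LP1(Θ); `#bad₂ ≤ #L₂` by `(hᵃ,hᵇ) ↔ (kᵃ,kᵇ)`).
The word-form objects are constructed explicitly (lengths extended by `1` beyond `r`), `e` is shown injective on thread positions from
`hAdisj`, `harc`, `hwinj`.
[cite: KozmaNitzan2024, Questions 8–9 (§5.5 p. 36) (context); Harris 1960]
-/

namespace Summit.CriticalPhenomena.PercolationContinuityZ3.Theorems

open Finset Literature.Probability.Percolation
open scoped symmDiff

namespace Coefficientwise

variable {ι V : Type*}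

open Classical in
/-- **THEOREM (`#bad₁(𝒱) ≤ #L₁(𝒱)` on every bundle, all monotone 0/1 levels, all up-closed events)** — consumer form of
`bundle_HEpure_cluster` (module docstring). [folklore] -/
theorem bundle_bad1_le_L1 (ends : ι → Sym2 V) (r : ℕ) (L : ℕ → ℕ) (hL : ∀ t, t < r → 1 ≤ L t)
    (w : ℕ → ℕ → V) (e : ℕ → ℕ → ι) (u b : V) (hr : 0 < r)
    (hw0 : ∀ t, t < r → w t 0 = u) (hwL : ∀ t, t < r → w t (L t) = b)
    (harc : ∀ t, t < r → ∀ j, 1 ≤ j → j ≤ L t → ends (e t j) = s(w t (j - 1), w t j))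
    (hwinj : ∀ t, t < r → ∀ i j, i ≤ L t → j ≤ L t → w t i = w t j → i = j)
    (hcross : ∀ t t', t < r → t' < r → t ≠ t' → ∀ i j, i ≤ L t → j ≤ L t' → w t i = w t' j → (i = 0 ∧ j = 0) ∨ (i = L t ∧ j = L t'))
    (A : ℕ → Finset ι) (hA : ∀ t, t < r → ∀ i, i ∈ A t ↔ ∃ j, 1 ≤ j ∧ j ≤ L t ∧ e t j = i)
    (hAdisj : ∀ t t', t < r → t' < r → t ≠ t' → Disjoint (A t) (A t'))
    (E : Finset ι) (hEA : ∀ i, i ∈ E ↔ ∃ t, t < r ∧ i ∈ A t)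
    (ha hb ka kb : Set V → Prop)
    (mha : ∀ S T : Set V, S ⊆ T → ha S → ha T) (mhb : ∀ S T : Set V, S ⊆ T → hb S → hb T)
    (mka : ∀ S T : Set V, S ⊆ T → ka S → ka T) (mkb : ∀ S T : Set V, S ⊆ T → kb S → kb T)
    (𝒱 : Finset ι → Prop) (hV : ∀ ⦃s t : Finset ι⦄, s ⊆ t → 𝒱 s → 𝒱 t) :
    (E.powerset.filter (fun ω => 𝒱 ω ∧
        (b ∉ openCluster (ends '' (↑ω : Set ι)) u ∧ b ∈ openCluster (ends '' (↑(E \ ω) : Set ι)) u) ∧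
        ha (openCluster (ends '' (↑ω : Set ι)) u) ∧ ¬ hb (openCluster (ends '' (↑(E \ ω) : Set ι)) u) ∧
        kb (openCluster (ends '' (↑(E \ ω) : Set ι)) u) ∧ ¬ ka (openCluster (ends '' (↑ω : Set ι)) u))).card ≤
    (E.powerset.filter (fun ω => 𝒱 ω ∧
        (b ∈ openCluster (ends '' (↑ω : Set ι)) u ∧ b ∉ openCluster (ends '' (↑(E \ ω) : Set ι)) u) ∧
        ha (openCluster (ends '' (↑ω : Set ι)) u) ∧ ¬ hb (openCluster (ends '' (↑(E \ ω) : Set ι)) u) ∧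
        kb (openCluster (ends '' (↑ω : Set ι)) u) ∧ ¬ ka (openCluster (ends '' (↑(E \ ω) : Set ι)) u))).card := by
  -- lengths extended beyond r
  obtain ⟨L', hL'⟩ : ∃ L' : ℕ → ℕ, ∀ t, L' t = if t < r then L t else 1 := ⟨_, fun _ => rfl⟩
  have hLr : ∀ t, t < r → L' t = L t := fun t ht => by rw [hL', if_pos ht]
  have hL1 : ∀ t, 1 ≤ L' t := fun t => by
    rw [hL']; split_ifs with h
    · exact hL t h
    · exact le_refl _
  have hwL' : ∀ t, t < r → w t (L' t) = b := fun t ht => by rw [hLr t ht]; exact hwL t ht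
  have harc' : ∀ t, t < r → ∀ j, 1 ≤ j → j ≤ L' t → ends (e t j) = s(w t (j - 1), w t j) :=
    fun t ht j h1 h2 => harc t ht j h1 (by rw [← hLr t ht]; exact h2)
  have hwinj' : ∀ t, t < r → ∀ i j, i ≤ L' t → j ≤ L' t → w t i = w t j → i = j :=
    fun t ht i j hi hj h => hwinj t ht i j (by rw [← hLr t ht]; exact hi) (by rw [← hLr t ht]; exact hj) h
  have hcross' : ∀ t t', t < r → t' < r → t ≠ t' → ∀ i j, i ≤ L' t → j ≤ L' t' → w t i = w t' j →
      (i = 0 ∧ j = 0) ∨ (i = L' t ∧ j = L' t') := by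
    intro t t' ht ht' hne i j hi hj h
    rw [hLr t ht, hLr t' ht']
    exact hcross t t' ht ht' hne i j (by rw [← hLr t ht]; exact hi) (by rw [← hLr t' ht']; exact hj) h
  have hE' : ∀ i, i ∈ E → ∃ t, t < r ∧ ∃ j, 1 ≤ j ∧ j ≤ L' t ∧ e t j = i := by
    intro i hi
    obtain ⟨t, ht, hiA⟩ := (hEA i).mp hi
    obtain ⟨j, hj1, hjL, hji⟩ := (hA t ht i).mp hiA
    exact ⟨t, ht, j, hj1, by rw [hLr t ht]; exact hjL, hji⟩
  have heE' : ∀ t, t < r → ∀ k, 1 ≤ k → k ≤ L' t → e t k ∈ E := fun t ht k h1 h2 =>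
    (hEA _).mpr ⟨t, ht, (hA t ht _).mpr ⟨k, h1, by rw [← hLr t ht]; exact h2, rfl⟩⟩
  have heinj' : ∀ p q : ℕ × ℕ, p.1 < r → 1 ≤ p.2 → p.2 ≤ L' p.1 → q.1 < r → 1 ≤ q.2 → q.2 ≤ L' q.1 →
      e p.1 p.2 = e q.1 q.2 → p = q := by
    intro p q hp1 hp2 hp3 hq1 hq2 hq3 heq
    rw [hLr _ hp1] at hp3; rw [hLr _ hq1] at hq3
    by_cases ht : p.1 = q.1
    · -- same thread: the edge determines its position
      have h1 := harc p.1 hp1 p.2 hp2 hp3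
      have h2 := harc q.1 hq1 q.2 hq2 hq3
      rw [heq] at h1
      rw [h1] at h2
      have hq1' : q.1 < r := hq1
      rw [← ht] at h2 hq3
      rcases Sym2.eq_iff.mp h2 with ⟨h3, _⟩ | ⟨h3, h4⟩
      · have := hwinj p.1 hp1 (p.2 - 1) (q.2 - 1) (by omega) (by omega) h3
        exact Prod.ext ht (by omega)
      · have e1 := hwinj p.1 hp1 (p.2 - 1) q.2 (by omega) hq3 h3
        have e2 := hwinj p.1 hp1 p.2 (q.2 - 1) hp3 (by omega) h4
        omega
    · exfalso
      have hpA : e p.1 p.2 ∈ A p.1 := (hA p.1 hp1 _).mpr ⟨p.2, hp2, hp3, rfl⟩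
      have hqA : e p.1 p.2 ∈ A q.1 := by rw [heq]; exact (hA q.1 hq1 _).mpr ⟨q.2, hq2, hq3, rfl⟩
      exact Finset.disjoint_left.mp (hAdisj p.1 q.1 hp1 hq1 ht) hpA hqA
  -- the word-form data, constructed
  obtain ⟨Et, hEt⟩ : ∃ Et : ℕ → Finset (ℕ × ℕ), ∀ n p, p ∈ Et n ↔ p.1 < n ∧ 1 ≤ p.2 ∧ p.2 ≤ L' p.1 := by
    refine ⟨fun n => (range n).biUnion (fun t => (Icc 1 (L' t)).image (Prod.mk t)), fun n p => ?_⟩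
    rw [Finset.mem_biUnion]
    constructor
    · rintro ⟨t, ht, hp⟩
      rw [hubB_mem_image_mk, Finset.mem_Icc] at hp
      obtain ⟨rfl, h1, h2⟩ := hp
      exact ⟨Finset.mem_range.mp ht, h1, h2⟩
    · rintro ⟨h0, h1, h2⟩
      exact ⟨p.1, Finset.mem_range.mpr h0, (hubB_mem_image_mk _ _ _).mpr ⟨rfl, Finset.mem_Icc.mpr ⟨h1, h2⟩⟩⟩
  obtain ⟨θ, hθ⟩ : ∃ θ : ℕ → Finset (ℕ × ℕ) → Finset ℕ, ∀ t ω k, k ∈ θ t ω ↔ (t, k) ∈ ω := by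
    refine ⟨fun t ω => (ω.filter (fun p => p.1 = t)).image Prod.snd, fun t ω k => ?_⟩
    show k ∈ (ω.filter (fun p => p.1 = t)).image Prod.snd ↔ (t, k) ∈ ω
    rw [Finset.mem_image]
    constructor
    · rintro ⟨p, hp, hpk⟩
      rw [Finset.mem_filter] at hp
      have : p = (t, k) := Prod.ext hp.2 hpk
      rw [this] at hp
      exact hp.1
    · intro h
      exact ⟨(t, k), Finset.mem_filter.mpr ⟨h, rfl⟩, rfl⟩
  obtain ⟨D, hD⟩ : ∃ D : ℕ → Finset ℕ → Finset ℕ, ∀ t η, D t η = (Icc 1 (L' t - 1)).filter (fun k => ¬ (k ∈ η ↔ k + 1 ∈ η)) :=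
    ⟨_, fun _ _ => rfl⟩
  obtain ⟨ri, hri⟩ : ∃ ri : ℕ → Finset ℕ → ℕ, ∀ t η, ri t η = if 1 ∈ η then (if h : (D t η).Nonempty then (D t η).min' h else L' t) else 0 :=
    ⟨_, fun _ _ => rfl⟩
  obtain ⟨ra, hra⟩ : ∃ ra : ℕ → Finset ℕ → ℕ, ∀ t η, ra t η = if 1 ∈ η then 0 else (if h : (D t η).Nonempty then (D t η).min' h else L' t) :=
    ⟨_, fun _ _ => rfl⟩
  obtain ⟨rj, hrj⟩ : ∃ rj : ℕ → Finset ℕ → ℕ, ∀ t η, rj t η = if L' t ∈ η then (if h : (D t η).Nonempty then L' t - (D t η).max' h else L' t) else 0 :=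
    ⟨_, fun _ _ => rfl⟩
  obtain ⟨rb, hrb⟩ : ∃ rb : ℕ → Finset ℕ → ℕ, ∀ t η, rb t η = if L' t ∈ η then 0 else (if h : (D t η).Nonempty then L' t - (D t η).max' h else L' t) :=
    ⟨_, fun _ _ => rfl⟩
  obtain ⟨TX, hTX⟩ : ∃ TX : Bool → ℕ → Finset (ℕ × ℕ) → Finset (ℕ × ℕ), ∀ g n ω, TX g n ω = (range n).biUnion (fun t => (Icc 0 (ri t (θ t ω)) ∪
      (if (g = true ∨ ∃ s, s < n ∧ ri s (θ s ω) = L' s) then Icc (L' t - rj t (θ t ω)) (L' t) else ∅)).image (Prod.mk t)) :=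
    ⟨_, fun _ _ _ => rfl⟩
  obtain ⟨TY, hTY⟩ : ∃ TY : Bool → ℕ → Finset (ℕ × ℕ) → Finset (ℕ × ℕ), ∀ g n ω, TY g n ω = (range n).biUnion (fun t => (Icc 0 (ra t (θ t ω)) ∪
      (if (g = true ∨ ∃ s, s < n ∧ ra s (θ s ω) = L' s) then Icc (L' t - rb t (θ t ω)) (L' t) else ∅)).image (Prod.mk t)) :=
    ⟨_, fun _ _ _ => rfl⟩
  exact bundle_HEpure_cluster ends r L' hL1 w e u b hr hw0 hwL' harc' hwinj' hcross' E hE' heE' heinj' Et hEt θ hθ D hD ri ra rj rb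
    hri hra hrj hrb TX TY hTX hTY ha hb ka kb mha mhb mka mkb 𝒱 (fun s t hst _ hs => hV hst hs)

end Coefficientwise

end Summit.CriticalPhenomena.PercolationContinuityZ3.Theorems
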